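import Summits.RiemannHypothesis.RiemannHypothesis.Theorems.LaplaceLoophole.Negative.LaplaceLoopholeResiduePhiC

/-!
# RiemannHypothesis / UniversalFactor — the residue of the wide window as a theta series
(negative-side support for crux `LaplaceLoophole`, item stmt-RiemannHypothesis-2575)

The tree's `wideKernelNoGo` (and the kill path `not_laplaceLoophole_of_noGo`) carries the hypothesis
`C(a) := ∫₀^∞ H_0(x) cosh(ax) dx ≠ 0` (`0 < a < π/8`), and `ExceptionalWideNoGo` is the case `C(a) = 0`.
With the complex continuation `Φ_ℂ` of the kernel (`UniversalFactor.deBruijnPhiC`,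
`LaplaceLoopholeResiduePhiC.lean`):

  `C(a) = (π/2) Φ_ℂ(ia)`  for real `|a| < π/8`  (`UniversalFactor.coshIntegral_eq_deBruijnPhiC`).

Proof: both sides are analytic in `a` on the strip `|Re a| < π/8` (dominated differentiation under
the integral from the Lagarias–Montague decay `e^{b|x|}|H_0(x)| ≤ C_b`, `b < π/8`;
`analyticOnNhd_deBruijnPhiC`) and agree on the imaginary axis `a = it`, where the identity is
Fourier inversion `∫₀^∞ H_0(x) cos(tx) dx = (π/2)Φ(t)` (`integral_Ioi_deBruijnH_zero_mul_cos`);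
conclude by the identity theorem. Numerically `Φ_ℂ(iy)` changes sign exactly once on `(0, π/8)`, at
`y₀ = 0.3194150268…` (kit job j013157 of the cdisprove seat), so the exceptional set of the wide
window is a single direction (see the crux workfile `Cruxes/LaplaceLoophole/Disproof.lean`).
-/

noncomputable section

namespace Summit.RiemannHypothesis.RiemannHypothesis.Theorems

open MeasureTheory Set Filter Complex Real
open scoped Topology FourierTransform
open Literature.NumberTheory.LFunctions

/-! ## The residue `C(a) = ∫₀^∞ H_0(x) cosh(ax) dx` is analytic on the strip `|Re a| < π/8` -/

/-- `‖cosh w‖ ≤ e^{|Re w|}`. [folklore] -/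
theorem UniversalFactor.norm_cosh_le_exp_abs_re (w : ℂ) : ‖Complex.cosh w‖ ≤ Real.exp |w.re| := by
  have h1 : ‖cexp w‖ ≤ Real.exp |w.re| := by
    rw [Complex.norm_exp]; exact Real.exp_le_exp.2 (le_abs_self _)
  have h2 : ‖cexp (-w)‖ ≤ Real.exp |w.re| := by
    rw [Complex.norm_exp, neg_re]; exact Real.exp_le_exp.2 (neg_le_abs _)
  have h3 := norm_add_le (cexp w) (cexp (-w))
  calc ‖Complex.cosh w‖ = ‖cexp w + cexp (-w)‖ / 2 := by
        rw [Complex.cosh, norm_div, Complex.norm_two]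
    _ ≤ Real.exp |w.re| := by linarith

/-- `‖sinh w‖ ≤ e^{|Re w|}`. [folklore] -/
theorem UniversalFactor.norm_sinh_le_exp_abs_re (w : ℂ) : ‖Complex.sinh w‖ ≤ Real.exp |w.re| := by
  have h1 : ‖cexp w‖ ≤ Real.exp |w.re| := by
    rw [Complex.norm_exp]; exact Real.exp_le_exp.2 (le_abs_self _)
  have h2 : ‖cexp (-w)‖ ≤ Real.exp |w.re| := by
    rw [Complex.norm_exp, neg_re]; exact Real.exp_le_exp.2 (neg_le_abs _)
  have h3 := norm_sub_le (cexp w) (cexp (-w))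
  calc ‖Complex.sinh w‖ = ‖cexp w - cexp (-w)‖ / 2 := by
        rw [Complex.sinh, norm_div, Complex.norm_two]
    _ ≤ Real.exp |w.re| := by linarith

/-- `x e^{−εx} ≤ 1/ε` for `ε > 0`, `x` real. [folklore] -/
theorem UniversalFactor.mul_exp_neg_le_inv {ε : ℝ} (hε : 0 < ε) (x : ℝ) :
    x * Real.exp (-ε * x) ≤ 1 / ε := by
  have h1 : ε * x ≤ Real.exp (ε * x) := by linarith [Real.add_one_le_exp (ε * x)]
  have h2 : Real.exp (-ε * x) * Real.exp (ε * x) = 1 := by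
    rw [← Real.exp_add]; simp
  have h3 : 0 < Real.exp (-ε * x) := Real.exp_pos _
  rw [le_div_iff₀ hε]
  calc x * Real.exp (-ε * x) * ε = ε * x * Real.exp (-ε * x) := by ring
    _ ≤ Real.exp (ε * x) * Real.exp (-ε * x) := mul_le_mul_of_nonneg_right h1 h3.le
    _ = 1 := by rw [mul_comm, h2]

/-- The strip `|Re a| < π/8` is open. [folklore] -/
theorem UniversalFactor.isOpen_reStrip : IsOpen {a : ℂ | |a.re| < Real.pi / 8} :=
  isOpen_lt (continuous_abs.comp Complex.continuous_re) continuous_const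

/-- **Differentiation under the integral sign**: on the strip `|Re a| < π/8` the residue
`a ↦ ∫₀^∞ H_0(x) cosh(ax) dx` has the derivative `∫₀^∞ H_0(x) x sinh(ax) dx` (dominated by
`(C/ε) e^{−εx}` via the Lagarias–Montague decay of `H_0`). [folklore] -/
theorem UniversalFactor.hasDerivAt_coshIntegral {a₀ : ℂ} (ha₀ : |a₀.re| < Real.pi / 8) :
    HasDerivAt (fun a : ℂ ↦ ∫ x in Ioi (0:ℝ), deBruijnH 0 (x : ℂ) * Complex.cosh (a * x))
      (∫ x in Ioi (0:ℝ), deBruijnH 0 (x : ℂ) * (Complex.sinh (a₀ * x) * x)) a₀ := by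
  set ε : ℝ := (Real.pi / 8 - |a₀.re|) / 4 with hε
  have hε0 : 0 < ε := by rw [hε]; linarith
  have hb : Real.pi / 8 - ε < Real.pi / 8 := by linarith
  obtain ⟨C, hC⟩ := UniversalFactorStandalone.exists_exp_mul_norm_deBruijnH_zero_le hb
  have hC0 : 0 ≤ C := le_trans (by positivity) (hC 0)
  have hHc : Continuous fun x : ℝ ↦ deBruijnH 0 (x : ℂ) :=
    (differentiable_deBruijnH_holds 0).continuous.comp Complex.continuous_ofReal
  -- pointwise decay of `H_0`
  have hH : ∀ x : ℝ, 0 < x → ‖deBruijnH 0 (x : ℂ)‖ ≤ C * Real.exp (-(Real.pi / 8 - ε) * x) := by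
    intro x hx
    have h := hC x
    rw [abs_of_pos hx] at h
    have he : Real.exp ((Real.pi / 8 - ε) * x) * Real.exp (-(Real.pi / 8 - ε) * x) = 1 := by
      rw [← Real.exp_add]; convert Real.exp_zero using 2; ring
    calc ‖deBruijnH 0 (x : ℂ)‖
        = Real.exp ((Real.pi / 8 - ε) * x) * ‖deBruijnH 0 (x : ℂ)‖ * Real.exp (-(Real.pi / 8 - ε) * x) := by
          rw [mul_comm (Real.exp _), mul_assoc, he, mul_one]
      _ ≤ C * Real.exp (-(Real.pi / 8 - ε) * x) := mul_le_mul_of_nonneg_right h (Real.exp_pos _).le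
  set F : ℂ → ℝ → ℂ := fun a x ↦ deBruijnH 0 (x : ℂ) * Complex.cosh (a * x) with hF
  set F' : ℂ → ℝ → ℂ := fun a x ↦ deBruijnH 0 (x : ℂ) * (Complex.sinh (a * x) * x) with hF'
  have hmeasF : ∀ a : ℂ, AEStronglyMeasurable (F a) (volume.restrict (Ioi (0:ℝ))) := fun a ↦
    (hHc.mul (Complex.continuous_cosh.comp (continuous_const.mul Complex.continuous_ofReal))).aestronglyMeasurable
  have hmeasF' : ∀ a : ℂ, AEStronglyMeasurable (F' a) (volume.restrict (Ioi (0:ℝ))) := fun a ↦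
    (hHc.mul ((Complex.continuous_sinh.comp (continuous_const.mul Complex.continuous_ofReal)).mul
      Complex.continuous_ofReal)).aestronglyMeasurable
  -- the real part of `a` on the ball
  have hre : ∀ a ∈ Metric.ball a₀ ε, |a.re| < Real.pi / 8 - 3 * ε := by
    intro a ha
    rw [Metric.mem_ball, Complex.dist_eq] at ha
    have h1 : |a.re - a₀.re| ≤ ‖a - a₀‖ := by
      rw [← Complex.sub_re]; exact Complex.abs_re_le_norm _
    have h2 : |a.re| ≤ |a₀.re| + |a.re - a₀.re| := by
      have := abs_add_le a₀.re (a.re - a₀.re); simp at this; linarith [abs_sub_comm a.re a₀.re]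
    have h3 : |a₀.re| = Real.pi / 8 - 4 * ε := by rw [hε]; ring
    linarith
  have key := hasDerivAt_integral_of_dominated_loc_of_deriv_le
    (μ := volume.restrict (Ioi (0:ℝ))) (F := F) (F' := F') (x₀ := a₀)
    (bound := fun x : ℝ ↦ C / ε * Real.exp (-ε * x)) (Metric.ball_mem_nhds a₀ hε0)
    (Eventually.of_forall hmeasF) ?_ (hmeasF' a₀) ?_ ?_ ?_
  · exact key.2
  · -- integrability of `F a₀`
    refine Integrable.mono' ((exp_neg_integrableOn_Ioi 0 (by positivity : (0:ℝ) < 3 * ε)).const_mul C)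
      (hmeasF a₀) (ae_restrict_of_forall_mem measurableSet_Ioi fun x (hx : 0 < x) ↦ ?_)
    simp only [hF]
    rw [norm_mul]
    have h1 : ‖Complex.cosh (a₀ * x)‖ ≤ Real.exp (|a₀.re| * x) := by
      refine (UniversalFactor.norm_cosh_le_exp_abs_re _).trans (le_of_eq ?_)
      rw [Complex.re_mul_ofReal, abs_mul, abs_of_pos hx]
    have h3 : |a₀.re| = Real.pi / 8 - 4 * ε := by rw [hε]; ring
    calc ‖deBruijnH 0 (x : ℂ)‖ * ‖Complex.cosh (a₀ * x)‖
        ≤ C * Real.exp (-(Real.pi / 8 - ε) * x) * Real.exp (|a₀.re| * x) :=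
          mul_le_mul (hH x hx) h1 (norm_nonneg _) (by positivity)
      _ = C * Real.exp (-(3 * ε) * x) := by
          rw [mul_assoc, ← Real.exp_add, h3]; ring_nf
  · -- the bound on `F'` over the ball
    refine ae_restrict_of_forall_mem measurableSet_Ioi fun x (hx : 0 < x) a ha ↦ ?_
    simp only [hF']
    rw [norm_mul, norm_mul, Complex.norm_real, Real.norm_eq_abs, abs_of_pos hx]
    have ha' := hre a ha
    have h1 : ‖Complex.sinh (a * x)‖ ≤ Real.exp ((Real.pi / 8 - 3 * ε) * x) := by
      refine (UniversalFactor.norm_sinh_le_exp_abs_re _).trans ?_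
      rw [Complex.re_mul_ofReal, abs_mul, abs_of_pos hx]
      exact Real.exp_le_exp.2 (by nlinarith)
    have h2 : x * Real.exp (-ε * x) ≤ 1 / ε := UniversalFactor.mul_exp_neg_le_inv hε0 x
    calc ‖deBruijnH 0 (x : ℂ)‖ * (‖Complex.sinh (a * x)‖ * x)
        ≤ C * Real.exp (-(Real.pi / 8 - ε) * x) * (Real.exp ((Real.pi / 8 - 3 * ε) * x) * x) :=
          mul_le_mul (hH x hx) (mul_le_mul_of_nonneg_right h1 hx.le) (by positivity) (by positivity)
      _ = C * (x * Real.exp (-ε * x)) * Real.exp (-ε * x) := by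
          rw [show C * (x * Real.exp (-ε * x)) * Real.exp (-ε * x) =
            C * x * (Real.exp (-ε * x) * Real.exp (-ε * x)) by ring, ← Real.exp_add,
            show C * Real.exp (-(Real.pi / 8 - ε) * x) * (Real.exp ((Real.pi / 8 - 3 * ε) * x) * x) =
            C * x * (Real.exp (-(Real.pi / 8 - ε) * x) * Real.exp ((Real.pi / 8 - 3 * ε) * x)) by ring,
            ← Real.exp_add]
          ring_nf
      _ ≤ C * (1 / ε) * Real.exp (-ε * x) := by gcongr
      _ = C / ε * Real.exp (-ε * x) := by ring
  · exact (exp_neg_integrableOn_Ioi 0 hε0).const_mul (C / ε)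
  · -- differentiability of the integrand in `a`
    refine ae_of_all _ fun x a _ ↦ ?_
    simp only [hF, hF']
    have h := ((Complex.hasDerivAt_cosh (a * (x : ℂ))).comp a (hasDerivAt_mul_const (x : ℂ))).const_mul
      (deBruijnH 0 (x : ℂ))
    simpa using h

/-- The residue is complex differentiable on the strip `|Re a| < π/8`. [folklore] -/
theorem UniversalFactor.differentiableOn_coshIntegral :
    DifferentiableOn ℂ (fun a : ℂ ↦ ∫ x in Ioi (0:ℝ), deBruijnH 0 (x : ℂ) * Complex.cosh (a * x))
      {a : ℂ | |a.re| < Real.pi / 8} := fun _ ha ↦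
  (UniversalFactor.hasDerivAt_coshIntegral ha).differentiableAt.differentiableWithinAt

/-- The residue is analytic on the strip `|Re a| < π/8`. [folklore] -/
theorem UniversalFactor.analyticOnNhd_coshIntegral :
    AnalyticOnNhd ℂ (fun a : ℂ ↦ ∫ x in Ioi (0:ℝ), deBruijnH 0 (x : ℂ) * Complex.cosh (a * x))
      {a : ℂ | |a.re| < Real.pi / 8} :=
  UniversalFactor.differentiableOn_coshIntegral.analyticOnNhd UniversalFactor.isOpen_reStrip


/-! ## The identity theorem: `C(a) = (π/2) Φ_ℂ(ia)` on the strip -/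

/-- On the imaginary axis the residue and `(π/2)Φ_ℂ(i·)` agree: `cosh(itx) = cos(tx)`,
`Φ_ℂ(−t) = Φ(−t) = Φ(t)`. [folklore] -/
theorem UniversalFactor.coshIntegral_I_mul (t : ℝ) :
    (∫ x in Ioi (0:ℝ), deBruijnH 0 (x : ℂ) * Complex.cosh ((I * t) * x)) =
      ((Real.pi / 2 : ℝ) : ℂ) * UniversalFactor.deBruijnPhiC (I * (I * t)) := by
  have h1 : ∀ x : ℝ, Complex.cosh ((I * t) * x) = Complex.cos (t * x) := by
    intro x; rw [show (I * t) * (x : ℂ) = (t * x) * I by ring, Complex.cosh_mul_I]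
  simp_rw [h1]
  rw [UniversalFactor.integral_Ioi_deBruijnH_zero_mul_cos]
  have h2 : I * (I * (t : ℂ)) = ((-t : ℝ) : ℂ) := by
    rw [← mul_assoc, Complex.I_mul_I]; push_cast; ring
  rw [h2, UniversalFactor.deBruijnPhiC_ofReal, show deBruijnPhi (-t) = deBruijnPhi t from
    deBruijnPhi_neg_holds t]

/-- **The residue as a theta series, complex form**: for `|Re a| < π/8`,
`∫₀^∞ H_0(x) cosh(ax) dx = (π/2) Φ_ℂ(ia)` (identity theorem on the strip: both sides are analytic
there and agree on the imaginary axis, which accumulates at `0`). [folklore] -/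
theorem UniversalFactor.coshIntegral_eq_deBruijnPhiC_complex {a : ℂ} (ha : |a.re| < Real.pi / 8) :
    (∫ x in Ioi (0:ℝ), deBruijnH 0 (x : ℂ) * Complex.cosh (a * x)) =
      ((Real.pi / 2 : ℝ) : ℂ) * UniversalFactor.deBruijnPhiC (I * a) := by
  set T : Set ℂ := {a : ℂ | |a.re| < Real.pi / 8} with hTdef
  have hL : AnalyticOnNhd ℂ
      (fun a : ℂ ↦ ∫ x in Ioi (0:ℝ), deBruijnH 0 (x : ℂ) * Complex.cosh (a * x)) T :=
    UniversalFactor.analyticOnNhd_coshIntegral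
  have hM : AnalyticOnNhd ℂ
      (fun a : ℂ ↦ ((Real.pi / 2 : ℝ) : ℂ) * UniversalFactor.deBruijnPhiC (I * a)) T := by
    intro b hb
    have hb' : |b.re| < Real.pi / 8 := hb
    have hIb : |(I * b).im| < Real.pi / 8 := by simpa using hb'
    have h1 : AnalyticAt ℂ UniversalFactor.deBruijnPhiC (I * b) :=
      UniversalFactor.analyticOnNhd_deBruijnPhiC _ hIb
    have h2 : AnalyticAt ℂ (fun a : ℂ ↦ I * a) b := analyticAt_const.mul analyticAt_id
    exact analyticAt_const.mul (h1.comp h2)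
  have hT : IsPreconnected T := by
    have hT' : T = {c : ℂ | -(Real.pi / 8) < c.re} ∩ {c : ℂ | c.re < Real.pi / 8} := by
      ext c; simp [hTdef, abs_lt]
    rw [hT']
    exact ((convex_halfSpace_re_gt _).inter (convex_halfSpace_re_lt _)).isPreconnected
  have h0 : (0:ℂ) ∈ T := by
    simp only [hTdef, Set.mem_setOf_eq, Complex.zero_re, abs_zero]; positivity
  -- the two sides agree along `I/(n+1) → 0`
  set z : ℕ → ℂ := fun n ↦ I * (((1:ℝ) / ((n:ℝ) + 1) : ℝ) : ℂ) with hz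
  have hz0 : Tendsto z atTop (𝓝[≠] (0:ℂ)) := by
    refine tendsto_nhdsWithin_iff.2 ⟨?_, Eventually.of_forall fun n ↦ ?_⟩
    · have h1 : Tendsto (fun n : ℕ ↦ (((1:ℝ) / ((n:ℝ) + 1) : ℝ) : ℂ)) atTop (𝓝 0) := by
        have := (Complex.continuous_ofReal.tendsto 0).comp
          (tendsto_one_div_add_atTop_nhds_zero_nat (𝕜 := ℝ))
        rw [Complex.ofReal_zero] at this
        exact this
      simpa [hz] using (tendsto_const_nhds (x := I)).mul h1
    · simp only [hz, Set.mem_compl_iff, Set.mem_singleton_iff, mul_eq_zero, Complex.I_ne_zero,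
        Complex.ofReal_eq_zero, false_or, one_div, inv_eq_zero]
      positivity
  have heq : ∀ n : ℕ, (fun a : ℂ ↦ ∫ x in Ioi (0:ℝ), deBruijnH 0 (x : ℂ) * Complex.cosh (a * x)) (z n) =
      (fun a : ℂ ↦ ((Real.pi / 2 : ℝ) : ℂ) * UniversalFactor.deBruijnPhiC (I * a)) (z n) :=
    fun n ↦ UniversalFactor.coshIntegral_I_mul _
  have hfreq : ∃ᶠ w in 𝓝[≠] (0:ℂ),
      (fun a : ℂ ↦ ∫ x in Ioi (0:ℝ), deBruijnH 0 (x : ℂ) * Complex.cosh (a * x)) w =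
        (fun a : ℂ ↦ ((Real.pi / 2 : ℝ) : ℂ) * UniversalFactor.deBruijnPhiC (I * a)) w :=
    hz0.frequently ((Eventually.of_forall heq).frequently)
  exact hL.eqOn_of_preconnected_of_frequently_eq hM hT h0 hfreq ha

/-- **The residue of the wide window is a theta series**: for real `|a| < π/8`,
`∫₀^∞ H_0(x) cosh(ax) dx = (π/2) Φ_ℂ(ia) = (π/2) Σ_{n≥1} (2π²n⁴e^{9ia} − 3πn²e^{5ia}) exp(−πn²e^{4ia})`.
This is the hypothesis of `wideKernelNoGo` / `ExceptionalWideNoGo` made computable. [folklore] -/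
theorem UniversalFactor.coshIntegral_eq_deBruijnPhiC {a : ℝ} (ha : |a| < Real.pi / 8) :
    (∫ x in Ioi (0:ℝ), deBruijnH 0 (x : ℂ) * (Real.cosh (a * x) : ℂ)) =
      ((Real.pi / 2 : ℝ) : ℂ) * UniversalFactor.deBruijnPhiC (I * a) := by
  have h := UniversalFactor.coshIntegral_eq_deBruijnPhiC_complex (a := (a : ℂ)) (by simpa using ha)
  rw [← h]
  refine setIntegral_congr_fun measurableSet_Ioi fun x _ ↦ ?_
  push_cast
  ring_nf

end Summit.RiemannHypothesis.RiemannHypothesis.Theorems
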